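import Literature.Computability.AlgebraicComplexity.BirkhoffShadowProofs
import Summits.ValiantsHypothesis.ValiantsHypothesis.Theorems.ShadowBirkhoff.Negative.Pencils

/-!
# ValiantsHypothesis / DivisionGap — `ShadowDegreeSplit`, planar lemmas (pencil form)

Helper file for item `stmt-ValiantsHypothesis-14894` (`ShadowDegreeSplit`, route `DivisionGap`).
The planar ingredients of Hrubeš–Yehudayoff's shadow bound for monotone formulas
(HrubesYehudayoff2021, Thm. 1 / Lemma 12), in the *pencil* rendering of the tree's
`Literature/Computability/AlgebraicComplexity/BirkhoffShadowProofs.lean`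
(`HrubesYehudayoff2021Prop23`): for additive `c d : G →+ ℝ`, `UM[c, d, X]` is the set of
points of `X` that are the unique maximiser over `X` of a functional `c + t • d` of the pencil.

* `ncard_um_union_le` — subadditivity over a union of two finite sets;
* `ncard_um_le_one`, `ncard_um_empty` — trivial upper bounds (with `ncard_um_le_ncard` of
  `Theorems/ShadowBirkhoff/Negative/Pencils.lean`);
* `ncard_um_le_ncard_um_add` — **monotonicity under a Minkowski summand**: if `B` is finite,
  nonempty and `(c, d)` separates the points of `B`, then `|UM(A)| ≤ |UM(A + B)|` (the pencil form
  of "a Minkowski summand of a polygon has at most as many vertices", HY21 Lemma 12);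
* `ncard_extremePoints_le_of_separating_pencils` — a bound `B` on `|UM(S)|` for every pencil
  separating the points of the plane gives `|vert conv S| ≤ 4B`, `S ⊆ ℝ²` finite (from
  `HrubesYehudayoff2021Prop23.extremePoints_subset_um4`: the four coordinate pencils separate).

## References

* P. Hrubeš, A. Yehudayoff, *Shadows of Newton polytopes*, CCC 2021, LIPIcs 200:9, Lemma 12,
  Thm. 1 [HrubesYehudayoff2021].
-/

noncomputable section

namespace Summit.ValiantsHypothesis.DivisionGap.ShadowDegreeSplit

open scoped Pointwise
open Literature.Computability.AlgebraicComplexity Summit.ValiantsHypothesis.Theorems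

section Pencil

variable {G : Type*} [AddCommGroup G] (c d : G →+ ℝ)

local notation3 (prettyPrint := false) "UM[" c ", " d ", " X "]" =>
  {p | p ∈ X ∧ ∃ t : ℝ, ∀ q ∈ X, q ≠ p → c q + t * d q < c p + t * d p}

/-- Uniquely supported points of a union of two sets are uniquely supported in one of them.
[folklore] -/
theorem um_union_subset (A B : Set G) : UM[c, d, A ∪ B] ⊆ UM[c, d, A] ∪ UM[c, d, B] := by
  rintro p ⟨hp, t, ht⟩
  rcases hp with hp | hp
  · exact Or.inl ⟨hp, t, fun q hq hne => ht q (Or.inl hq) hne⟩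
  · exact Or.inr ⟨hp, t, fun q hq hne => ht q (Or.inr hq) hne⟩

/-- Subadditivity of the number of uniquely supported points over a union of two finite sets.
[folklore] -/
theorem ncard_um_union_le (A B : Set G) (hA : A.Finite) (hB : B.Finite) :
    (UM[c, d, A ∪ B]).ncard ≤ (UM[c, d, A]).ncard + (UM[c, d, B]).ncard :=
  (Set.ncard_le_ncard (um_union_subset c d A B)
    ((hA.subset (HrubesYehudayoff2021Prop23.um_subset c d A)).union
      (hB.subset (HrubesYehudayoff2021Prop23.um_subset c d B)))).trans (Set.ncard_union_le _ _)

/-- A set with at most one point has at most one uniquely supported point. [folklore] -/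
theorem ncard_um_le_one {X : Set G} (hX : X.Subsingleton) : (UM[c, d, X]).ncard ≤ 1 := by
  rcases hX.eq_empty_or_singleton with h | ⟨x, h⟩
  · rw [h]
    calc (UM[c, d, (∅ : Set G)]).ncard ≤ (∅ : Set G).ncard :=
          ShadowBirkhoffNegative.ncard_um_le_ncard c d _ Set.finite_empty
      _ = 0 := Set.ncard_empty G
      _ ≤ 1 := Nat.zero_le _
  · rw [h]
    calc (UM[c, d, ({x} : Set G)]).ncard ≤ ({x} : Set G).ncard :=
          ShadowBirkhoffNegative.ncard_um_le_ncard c d _ (Set.finite_singleton x)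
      _ = 1 := Set.ncard_singleton x
      _ ≤ 1 := le_rfl

/-- The empty set has no uniquely supported points. [folklore] -/
theorem ncard_um_empty : (UM[c, d, (∅ : Set G)]).ncard = 0 := by
  have h := ShadowBirkhoffNegative.ncard_um_le_ncard c d (∅ : Set G) Set.finite_empty
  rw [Set.ncard_empty] at h
  exact Nat.le_zero.1 h

/-- The set of pencil parameters at which `p` is the unique maximiser over a finite `X` is open.
[folklore] -/
theorem isOpen_params (X : Set G) (hX : X.Finite) (p : G) :
    IsOpen {t : ℝ | ∀ q ∈ X, q ≠ p → c q + t * d q < c p + t * d p} := by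
  have h : {t : ℝ | ∀ q ∈ X, q ≠ p → c q + t * d q < c p + t * d p} =
      ⋂ q ∈ X \ {p}, {t : ℝ | c q + t * d q < c p + t * d p} := by
    ext t
    simp only [Set.mem_setOf_eq, Set.mem_iInter, Set.mem_sdiff, Set.mem_singleton_iff, and_imp]
  rw [h]
  refine (hX.subset Set.sdiff_subset).isOpen_biInter fun q _ => ?_
  exact isOpen_lt (continuous_const.add (continuous_id.mul continuous_const))
    (continuous_const.add (continuous_id.mul continuous_const))

/-- A nonempty open set of reals is infinite. [folklore] -/
theorem infinite_of_isOpen {T : Set ℝ} (hT : IsOpen T) {t₀ : ℝ} (ht₀ : t₀ ∈ T) :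
    T.Infinite := by
  obtain ⟨ε, hε, hball⟩ := Metric.isOpen_iff.1 hT t₀ ht₀
  rw [Real.ball_eq_Ioo] at hball
  exact (Set.Ioo_infinite (by linarith)).mono hball

/-- **Monotonicity under a Minkowski summand** (pencil form of HY21 Lemma 12: in the plane a
Minkowski summand has at most as many vertices as the sum). If `B` is finite and nonempty and the
pair `(c, d)` separates the points of `B`, then every point uniquely supported in `A` gives rise,
injectively, to a point uniquely supported in `A + B`: perturb the parameter inside the open
interval where `p` stays the unique maximiser so that the maximiser over `B` is unique too.
[cite: HrubesYehudayoff2021, Lemma 12] -/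
theorem ncard_um_le_ncard_um_add (A B : Set G) (hA : A.Finite) (hB : B.Finite)
    (hBne : B.Nonempty) (hinj : ∀ b ∈ B, ∀ b' ∈ B, c b = c b' → d b = d b' → b = b') :
    (UM[c, d, A]).ncard ≤ (UM[c, d, A + B]).ncard := by
  -- the finitely many parameters at which two separated points of `B` tie
  set Bad : Set ℝ := (fun bb : G × G => (c bb.2 - c bb.1) / (d bb.1 - d bb.2)) '' (B ×ˢ B)
    with hBad
  have hBadfin : Bad.Finite := (hB.prod hB).image _
  -- for every uniquely supported point of `A`, a good parameter and the maximiser over `B`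
  have key : ∀ p ∈ UM[c, d, A], ∃ t : ℝ, ∃ b : G,
      (∀ q ∈ A, q ≠ p → c q + t * d q < c p + t * d p) ∧ b ∈ B ∧
        (∀ b' ∈ B, b' ≠ b → c b' + t * d b' < c b + t * d b) := by
    rintro p ⟨hpA, t₀, ht₀⟩
    have hinf :
        ({t : ℝ | ∀ q ∈ A, q ≠ p → c q + t * d q < c p + t * d p} \ Bad).Infinite :=
      (infinite_of_isOpen (isOpen_params c d A hA p) ht₀).sdiff hBadfin
    obtain ⟨t, ht, htBad⟩ := hinf.nonempty
    obtain ⟨b, hbB, hbmax⟩ := Set.exists_max_image B (fun b => c b + t * d b) hB hBne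
    refine ⟨t, b, ht, hbB, fun b' hb' hne => ?_⟩
    refine lt_of_le_of_ne (hbmax b' hb') fun heq => ?_
    by_cases hd : d b' = d b
    · have hc : c b' = c b := by rw [hd] at heq; linarith
      exact hne (hinj b' hb' b hbB hc hd)
    · refine htBad ⟨(b', b), Set.mk_mem_prod hb' hbB, ?_⟩
      have hd' : d b' - d b ≠ 0 := sub_ne_zero.2 hd
      field_simp
      linarith
  choose! tt bb htt hbbB hbb using key
  -- the injection `p ↦ p + b_p`
  have hmaps : Set.MapsTo (fun p => p + bb p) UM[c, d, A] UM[c, d, A + B] := by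
    intro p hp
    have hpA : p ∈ A := hp.1
    refine ⟨Set.add_mem_add hpA (hbbB p hp), tt p, fun q hq hne => ?_⟩
    obtain ⟨a, ha, b, hb, rfl⟩ := Set.mem_add.1 hq
    have h1 : c a + tt p * d a ≤ c p + tt p * d p := by
      by_cases hap : a = p
      · rw [hap]
      · exact (htt p hp a ha hap).le
    have h2 : c b + tt p * d b ≤ c (bb p) + tt p * d (bb p) := by
      by_cases hbp : b = bb p
      · rw [hbp]
      · exact (hbb p hp b hb hbp).le
    have h3 : c a + tt p * d a < c p + tt p * d p ∨
        c b + tt p * d b < c (bb p) + tt p * d (bb p) := by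
      by_cases hap : a = p
      · right
        have hbp : b ≠ bb p := fun hbp => hne (by rw [hap, hbp])
        exact hbb p hp b hb hbp
      · exact Or.inl (htt p hp a ha hap)
    simp only [map_add]
    rcases h3 with h3 | h3 <;> nlinarith
  have hinjOn : Set.InjOn (fun p => p + bb p) UM[c, d, A] := by
    intro p hp p' hp' heq
    by_contra hne
    have h1 : c p' + tt p * d p' < c p + tt p * d p := htt p hp p' hp'.1 (Ne.symm hne)
    have h2 : c (bb p') + tt p * d (bb p') ≤ c (bb p) + tt p * d (bb p) := by
      by_cases hbp : bb p' = bb p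
      · rw [hbp]
      · exact (hbb p hp (bb p') (hbbB p' hp') hbp).le
    have h3 : c (p' + bb p') + tt p * d (p' + bb p') = c (p + bb p) + tt p * d (p + bb p) := by
      simp only at heq
      rw [heq]
    simp only [map_add] at h3
    nlinarith
  exact Set.ncard_le_ncard_of_injOn _ hmaps hinjOn
    ((hA.add hB).subset (HrubesYehudayoff2021Prop23.um_subset c d (A + B)))

end Pencil

/-! ### The plane: four coordinate pencils -/

section Plane

local notation3 (prettyPrint := false) "UM[" c ", " d ", " X "]" =>
  {p | p ∈ X ∧ ∃ t : ℝ, ∀ q ∈ X, q ≠ p → c q + t * d q < c p + t * d p}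

/-- **Vertices versus separating pencils.** If every pencil `(c, d)` of additive functionals that
separates the points of the plane (`c b = c b' → d b = d b' → b = b'`) supports uniquely at most
`B` points of the finite planar set `S`, then `conv S` has at most `4B` vertices: every vertex is
uniquely supported by one of the four coordinate pencils `±x₀ + t x₁`, `±x₁ + t x₀`
(`HrubesYehudayoff2021Prop23.extremePoints_subset_um4`), each of which separates points.
[folklore] -/
theorem ncard_extremePoints_le_of_separating_pencils (S : Set (Fin 2 → ℝ)) (hS : S.Finite)
    (B : ℕ)
    (hB : ∀ c d : (Fin 2 → ℝ) →+ ℝ,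
      (∀ b b' : Fin 2 → ℝ, c b = c b' → d b = d b' → b = b') →
        (UM[c, d, S]).ncard ≤ B) :
    (Set.extremePoints ℝ (convexHull ℝ S)).ncard ≤ 4 * B := by
  set c₀ : (Fin 2 → ℝ) →+ ℝ := Pi.evalAddMonoidHom (fun _ : Fin 2 => ℝ) 0 with hc₀
  set c₁ : (Fin 2 → ℝ) →+ ℝ := Pi.evalAddMonoidHom (fun _ : Fin 2 => ℝ) 1 with hc₁
  have e₀ : ∀ x : Fin 2 → ℝ, c₀ x = x 0 := fun _ => rfl
  have e₁ : ∀ x : Fin 2 → ℝ, c₁ x = x 1 := fun _ => rfl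
  have hext : ∀ b b' : Fin 2 → ℝ, b 0 = b' 0 → b 1 = b' 1 → b = b' := by
    intro b b' h0 h1
    funext i
    fin_cases i
    · exact h0
    · exact h1
  have s₁ : ∀ b b' : Fin 2 → ℝ, c₀ b = c₀ b' → c₁ b = c₁ b' → b = b' :=
    fun b b' h0 h1 => hext b b' h0 h1
  have s₂ : ∀ b b' : Fin 2 → ℝ, (-c₀) b = (-c₀) b' → c₁ b = c₁ b' → b = b' := by
    intro b b' h0 h1
    simp only [AddMonoidHom.neg_apply, neg_inj] at h0
    exact s₁ b b' h0 h1
  have s₃ : ∀ b b' : Fin 2 → ℝ, c₁ b = c₁ b' → c₀ b = c₀ b' → b = b' :=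
    fun b b' h1 h0 => s₁ b b' h0 h1
  have s₄ : ∀ b b' : Fin 2 → ℝ, (-c₁) b = (-c₁) b' → c₀ b = c₀ b' → b = b' := by
    intro b b' h1 h0
    simp only [AddMonoidHom.neg_apply, neg_inj] at h1
    exact s₁ b b' h0 h1
  have h4 := HrubesYehudayoff2021Prop23.extremePoints_subset_um4 c₀ c₁ e₀ e₁ S hS
  have hf : ∀ c d : (Fin 2 → ℝ) →+ ℝ, (UM[c, d, S]).Finite :=
    fun c d => hS.subset fun p hp => hp.1
  refine (Set.ncard_le_ncard h4
    ((((hf _ _).union (hf _ _)).union (hf _ _)).union (hf _ _))).trans ?_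
  have u1 := Set.ncard_union_le (UM[c₀, c₁, S] ∪ UM[(-c₀), c₁, S] ∪ UM[c₁, c₀, S])
    UM[(-c₁), c₀, S]
  have u2 := Set.ncard_union_le (UM[c₀, c₁, S] ∪ UM[(-c₀), c₁, S]) UM[c₁, c₀, S]
  have u3 := Set.ncard_union_le UM[c₀, c₁, S] UM[(-c₀), c₁, S]
  have b1 := hB c₀ c₁ s₁
  have b2 := hB (-c₀) c₁ s₂
  have b3 := hB c₁ c₀ s₃
  have b4 := hB (-c₁) c₀ s₄
  omega

end Plane

end Summit.ValiantsHypothesis.DivisionGap.ShadowDegreeSplit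

end
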